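import Mathlib
import Literature.Computability.AlgebraicComplexity.StandardFamilies
import Literature.Computability.AlgebraicComplexity.DeterminantalConormalBound
import Literature.RingTheory.Nullstellensatz.SkodaBrownawellDegreeBound
import Summits.ValiantsHypothesis.ValiantsHypothesis.Theses.RefutationDegree
import Summits.ValiantsHypothesis.ValiantsHypothesis.Theorems.RefutationDegreeDefs
import Summits.ValiantsHypothesis.ValiantsHypothesis.Theorems.RefutationDegreeRefutationBarrierConverse
import Summits.ValiantsHypothesis.ValiantsHypothesis.Theorems.RefutationDegreeBeyondHessianNsStubOddInfeasible
import Summits.ValiantsHypothesis.ValiantsHypothesis.Theorems.RefutationDegreeRefutationBarrierStubBorderSections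
import Summits.ValiantsHypothesis.ValiantsHypothesis.Theorems.RefutationDegreeRefutationBarrierStubPolarPersistenceCoeff
import Summits.ValiantsHypothesis.ValiantsHypothesis.Theorems.RefutationDegreeRefutationBarrierStubTwistNondegenerate
import Summits.ValiantsHypothesis.ValiantsHypothesis.Theorems.RefutationDegreeRefutationBarrierStubBorderGapDichotomy
import Summits.ValiantsHypothesis.ValiantsHypothesis.Theorems.RefutationDegreeRefutationBarrierStubNcFullRankOfBalanced
import Summits.ValiantsHypothesis.ValiantsHypothesis.Theorems.RefutationDegreeRefutationBarrierSectionalTransfer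
import Summits.ValiantsHypothesis.ValiantsHypothesis.Theorems.RefutationDegreeRefutationBarrierWitnessExp

/-!
# Crux `RefutationDegree.RefutationBarrier` (stmt-ValiantsHypothesis-5642) — line `Sketch_ideator5`
(cards `kernel-pair-rays-plus-one` + `balanced-singular-limits`, NEGATION lens): lead c2 skeleton, v2

Everything of the line except its research content has LANDED (wave 1 + lead, 2026-08-17):
* T1 `stub_borderSections` p134533, T2 `stub_polarPersistenceCoeff` p134377, T3 `stub_twistNondegenerate`
  p134144 (border sequence ⇒ converging determinantal forms on a section; IFT persistence in the
  coefficients; twisting by a unit);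
* D1 `stub_border_gap_dichotomy` p135012 (+ Aux p134772: Kempf–Ness first-order conditions) and
  D2 `stub_ncFullRank_of_balanced` p134360 (the card's confinement lever);
* `RefutationDegreeRefutationBarrierSectionalTransfer` p134947: the BORDER TRANSFER
  `notInBorder_of_sectionalWitness` (InBorder n m ∧ a linear section of per_n with > B(m,N)
  non-degenerate polar points ⟹ False; unconditional), `io_notInBorder_of_sectionalWitnessQuad`,
  `not_refutationBarrier_of_sectionalWitnessQuad` (SB ∧ W ⟹ ¬crux);
* `RefutationDegreeRefutationBarrierWitnessExp` p134982: crux 0318's registered research stub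
  `stub_sectionalWitness` implies W (`sectionalWitnessQuad_of_witnessExp`).

The ONE open stub is the research content W = `stub_sectionalWitnessQuad`; the deciding theorem
`RefutationBarrierFalseModSB_proof : SB → ¬ RefutationBarrier` is kernel-checked modulo it.  Lead's
conjectural route to W (workfile `CLASSFORMULA.md`): class(P_n) = n·N((n−2)^{×n})/(n−1) with N the
GKZ hyperdeterminant degree (hyperplane-pencil reduction of the polar count; = 6 at n = 3, matching the
DetQP numerics), which exceeds B(⌊n²/2⌋+1, n²) from n = 5 on — W at the top rung, L = identity.
-/

set_option linter.dupNamespace false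

noncomputable section

namespace Summit.ValiantsHypothesis.ValiantsHypothesis.Theorems.RefutationDegree

open scoped BigOperators
open Filter Topology MvPolynomial Matrix
open Literature.Computability.AlgebraicComplexity (perPoly perPoly_isHomogeneous HasDetRepr polarSet
  conormalBezout)
open Literature.RingTheory.Nullstellensatz (skodaBrownawellDegreeBound)
open Summit.ValiantsHypothesis.ValiantsHypothesis.Theses.RefutationDegree
open Summit.ValiantsHypothesis.ValiantsHypothesis.Theorems.RefutationDegreeBeyondHessianNs
  (sq_add_two_le_two_mul_of_hasDetRepr_perPoly not_hasDetRepr_of_odd)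

/-! ## The research stub (W): a sectional class of the permanental hypersurface beats `B(⌊n²/2⌋+1, N)` -/

/-- **Stub W (research content of the line, certificate form).**  For infinitely many `n` there are
a linear section `per_n ∘ L` of the permanent in `N ≥ 3` variables (`L` a tuple of linear forms),
one pencil/chart datum `(a, b, c)` and a finite set `F` of NON-DEGENERATE polar points of the
section (`per_n∘L (x) = 0`, `∇ ≠ 0`, `∇ ∈ ℂa + ℂb`, `c·x = 1`, bordered-Hessian Jacobian invertible)
with MORE than `B(⌊n²/2⌋+1, N)` elements (`conormalBezout`, Sheshadri's two-kernel Bézout number).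
By `notInBorder_of_sectionalWitness` (landed) this is a border lower bound
`\overline{dc}_aff(per_n) ≥ ⌊n²/2⌋+2` infinitely often (LMR13 + 1), hence research-sized; it is
IMPLIED by crux 0318's registered `stub_sectionalWitness` (`sectionalWitnessQuad_of_witnessExp`,
landed).  Conjectural route (lead c2, `CLASSFORMULA.md`): at the top rung (`L` = identity, `N = n²`)
the class of `P_n` is `n·N((n−2)^{×n})/(n−1)` (`N` = degree of the hyperdeterminant of format
`(n−1)^{×n}`): `2, 6, 1692, 58976320, 5.7·10¹⁴, …`, equal to `6 = class(P_3)` (DetQP numerics) and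
exceeding `B(⌊n²/2⌋+1, n²)` for every `n ≥ 5` (ratio `1.74, 378, 3·10⁹, …`); it holds iff the
row-restricted hyperdeterminant of `per_n` on `(ℙ^{n−1∨})ⁿ` is a reduced section whose zero locus
meets a generic diagonal line away from the locus of restrictions with identically vanishing slot
contractions (true at `n = 3`; kit tests at `n = 4, 5` filed).  Why it might fail: a non-reduced
restricted hyperdeterminant (a det-like collapse: for `det_n` the section vanishes identically).
[difficulty: open-problem] -/
theorem stub_sectionalWitnessQuad : ∀ n₀ : ℕ, ∃ n ≥ n₀, ∃ N : ℕ, 3 ≤ N ∧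
    ∃ L : Fin n × Fin n → MvPolynomial (Fin N) ℂ, (∀ e, (L e).IsHomogeneous 1) ∧
      ∃ (a b c : Fin N → ℂ) (F : Finset (Fin N → ℂ)),
        (∀ x ∈ F, x ∈ polarSet (aeval L (perPoly (Fin n) ℂ)) a b c ∧
          (Matrix.fromBlocks
            (Matrix.of fun i j : Fin N => eval x (pderiv i (pderiv j (aeval L (perPoly (Fin n) ℂ)))))
            (Matrix.of fun (i : Fin N) (l : Fin 2) => ![a i, b i] l)
            (Matrix.of fun (l : Fin 2) (j : Fin N) =>
              ![eval x (pderiv j (aeval L (perPoly (Fin n) ℂ))), c j] l)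
            (0 : Matrix (Fin 2) (Fin 2) ℂ)).det ≠ 0) ∧
        conormalBezout (n ^ 2 / 2 + 1) N < F.card := by
  sorry

/-! ## Composition (lead): the deciding theorem, from the landed border transfer -/

/-- **The line's deciding theorem: `¬ RefutationBarrier` modulo Skoda–Brownawell**, from the
research stub W through the landed border transfer `not_refutationBarrier_of_sectionalWitnessQuad`
(which chains `notInBorder_of_sectionalWitness`, `io_notInBorder_of_sectionalWitnessQuad` and the
converse `not_refutationBarrier_of_io_notInBorder`). -/
theorem not_RefutationBarrier_of
    (hSB : ∀ n m : ℕ, skodaBrownawellDegreeBound (σ := Unk n m) (ι := (Fin n × Fin n) →₀ ℕ)) :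
    ¬ RefutationBarrier :=
  not_refutationBarrier_of_sectionalWitnessQuad hSB stub_sectionalWitnessQuad

/-- **What this NEGATION line settles** (deciding statement for `ledger skeleton check`, which
matches conclusions by head symbol and cannot see through `¬`): the crux `RefutationBarrier` is
FALSE modulo the named analytic fact `skodaBrownawellDegreeBound`. -/
def RefutationBarrierFalseModSB : Prop :=
  (∀ n m : ℕ, skodaBrownawellDegreeBound (σ := Unk n m) (ι := (Fin n × Fin n) →₀ ℕ)) →
    ¬ RefutationBarrier

/-- The skeleton closes `RefutationBarrierFalseModSB` modulo its single registered stub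
`stub_sectionalWitnessQuad`. -/
theorem RefutationBarrierFalseModSB_proof : RefutationBarrierFalseModSB :=
  fun hSB => not_RefutationBarrier_of hSB

/-! ## The card's exact half (landed) and the confinement by-product (landed stubs D1, D2) -/

/-- **Mignon–Ressayre + 1** (card `kernel-pair-rays-plus-one`, first lemma; LANDED as
`…RefutationDegreeBeyondHessianNs.sq_add_two_le_two_mul_of_hasDetRepr_perPoly`, p111216): for
`n ≥ 3` every affine determinantal expression of `per_n` of size `m` has `n² + 2 ≤ 2m`. -/
theorem mr_plus_one {n m : ℕ} (hn : 3 ≤ n) (h : HasDetRepr (perPoly (Fin n) ℂ) m) :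
    n ^ 2 + 2 ≤ 2 * m :=
  sq_add_two_le_two_mul_of_hasDetRepr_perPoly hn h

/-- **Confinement of the border gap at the critical odd size** (cards 1 + 2 composed; D1 p135012,
D2 p134360, MR+1 p111216): at odd `n ≥ 3`, affine border membership of `per_n` at size `⌊n²/2⌋+1`
— which the crux forces for all large `n` modulo SB — can only come from a sup-norm-one BALANCED
tuple spanning a SINGULAR matrix space of full non-commutative rank (an Edmonds-gap space). -/
theorem balancedSingular_of_inBorder_odd {n : ℕ} (hn : 3 ≤ n) (ho : Odd n)
    (hb : InBorder n (n ^ 2 / 2 + 1)) :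
    ∃ W : Unk n (n ^ 2 / 2 + 1) → ℂ, ‖W‖ = 1 ∧
      (∃ α : ℝ,
        (∑ t : Option (Fin n × Fin n),
            (Matrix.of fun i j : Fin (n ^ 2 / 2 + 1) => W (t, (i, j))) *
              (Matrix.of fun i j : Fin (n ^ 2 / 2 + 1) => W (t, (i, j)))ᴴ) =
          (α : ℂ) • (1 : Matrix (Fin (n ^ 2 / 2 + 1)) (Fin (n ^ 2 / 2 + 1)) ℂ) ∧
        (∑ t : Option (Fin n × Fin n),
            (Matrix.of fun i j : Fin (n ^ 2 / 2 + 1) => W (t, (i, j)))ᴴ *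
              (Matrix.of fun i j : Fin (n ^ 2 / 2 + 1) => W (t, (i, j)))) =
          (α : ℂ) • (1 : Matrix (Fin (n ^ 2 / 2 + 1)) (Fin (n ^ 2 / 2 + 1)) ℂ)) ∧
      (∀ μ : (Fin n × Fin n) →₀ ℕ, eval W (((pencil n (n ^ 2 / 2 + 1)).det).coeff μ) = 0) ∧
      ∀ U : Submodule ℂ (Fin (n ^ 2 / 2 + 1) → ℂ),
        Module.finrank ℂ U ≤
          Module.finrank ℂ
            ↥(⨆ t : Option (Fin n × Fin n),
                U.map (Matrix.toLin'
                  (Matrix.of fun i j : Fin (n ^ 2 / 2 + 1) => W (t, (i, j))))) := by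
  rcases stub_border_gap_dichotomy n (n ^ 2 / 2 + 1) hb with h | ⟨W, hW1, hbal, hsing⟩
  · exact absurd h (not_hasDetRepr_of_odd hn ho)
  · have hW0 : W ≠ 0 := by
      rintro rfl
      simp at hW1
    exact ⟨W, hW1, hbal, hsing, stub_ncFullRank_of_balanced n _ W hW0 hbal⟩

end Summit.ValiantsHypothesis.ValiantsHypothesis.Theorems.RefutationDegree

end
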